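import Summits.MatrixMultiplication.OmegaCensus.SmallFormats.MatMul229GF3CoverSpec
import HarnessLib

/-!
# ω-census family (a): the `(9,30)` cover certificate over `𝔽₃` — the case systems and the cover theorem

Cell `pub-omega` (unit `pub-omega-tensor`, gen 41), topic `Summits/MatrixMultiplication/OmegaCensus` (sub-folder
`SmallFormats`). Framing (verbatim): lottery ticket; floor = certified bounds/negative ranges. HONEST FRAMING: bookkeeping — second half of
the glue between the loaded-branch clause system `Cover930.Adm930` (`MatMul229GF3CoverSpec`) and the kernel replays of the branch-and-bound
certificate (`Cover930.runN`, `runK*`, `runG`, `runT`, `runD`): the literal systems `rowsN` / `rowsA` mean what they should (`sat_rowsN`,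
`sat_rowsA`: row-by-row identification with the clause loads, table = functional spec by `decide`), the boxes, listed solutions ⇒ words
(`word_of_listed`), WLOG 2 (translate a present invertible class to `0`, conjugate a present 4-cycle / 3-cycle / transposition to `1` / `5` / `4`
with the words of `MatMul227GF3EnumWLOG`) and the cover theorem `cover930_of_covers` (the replays enter as `BoxCover.Covers` HYPOTHESES).
Nothing here is a bound on any rank; nothing on `ω`.
-/

namespace Summit.MatrixMultiplication.OmegaCensus.SmallFormats.Cover930

open Finset Enum723 BoxCover

set_option maxRecDepth 4000

/-! ## The literal systems mean what they should -/

/-- Row of clause `k`: the incidence column as integers. -/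
def incRowZ (k : ℕ) : List ℤ := (List.range 40).map fun a => (inc a k : ℤ)

/-- Negated row of clause `k`. -/
def negIncRowZ (k : ℕ) : List ℤ := (List.range 40).map fun a => -(inc a k : ℤ)

/-- Difference of two clause rows. -/
def diffRowZ (k₁ k₂ : ℕ) : List ℤ := (List.range 40).map fun a => (inc a k₁ : ℤ) - inc a k₂

/-- The all-ones row (total). -/
def onesRowZ : List ℤ := (List.range 40).map fun _ => (1 : ℤ)

/-- The negated all-ones row. -/
def negOnesRowZ : List ℤ := (List.range 40).map fun _ => (-1 : ℤ)

/-- Minus the indicator of the rank-one classes (`σ`). -/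
def rk1RowZ : List ℤ := (List.range 40).map fun a => if 24 ≤ a then (-1 : ℤ) else 0

/-- The common rows `0–84`: clauses with caps, total `≤ 30`, total `≥ 30`, `σ ≥ 14`. -/
def baseSpec (k : ℕ) : List ℤ × ℤ :=
  if k < 82 then (incRowZ k, (cap930 k : ℤ)) else if k = 82 then (onesRowZ, 30) else if k = 83 then (negOnesRowZ, -30) else (rk1RowZ, -14)

/-- The rows of `rowsN`, functionally. -/
def specN (k : ℕ) : List ℤ × ℤ :=
  if k < 85 then baseSpec k
  else if k = 85 then (diffRowZ 33 32, 0) else if k = 86 then (diffRowZ 34 33, 0) else if k = 87 then (diffRowZ 35 34, 0)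
  else if k = 88 then (diffRowZ 37 36, 0) else if k = 89 then (diffRowZ 38 37, 0) else if k = 90 then (diffRowZ 39 38, 0)
  else if k = 91 then (negIncRowZ 32, -4) else if k = 92 then (negIncRowZ 36, -4) else (incRowZ 35, 3)

/-- The rows of `rowsA`, functionally. -/
def specA (k : ℕ) : List ℤ × ℤ := if k < 85 then baseSpec k else (negIncRowZ (k - 85 + 32), -4)

/-- The literal table `rowsN` is the functional one. -/
theorem rowsN_eq : rowsN.length = 94 ∧ ∀ k, k < 94 → rowsN.getD k ([], 0) = specN k := by decide +kernel

/-- The literal table `rowsA` is the functional one. -/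
theorem rowsA_eq : rowsA.length = 93 ∧ ∀ k, k < 93 → rowsA.getD k ([], 0) = specA k := by decide +kernel

/-- Value of a mapped row. -/
theorem rowVal_map (f : ℕ → ℤ) (c : ℕ → ℕ) : rowVal 40 ((List.range 40).map f) c = ∑ a ∈ range 40, f a * (c a : ℤ) := by
  refine Finset.sum_congr rfl fun a ha => ?_
  have ha' := Finset.mem_range.mp ha
  rw [List.getD_eq_getElem?_getD, List.getElem?_map, List.getElem?_range ha']
  rfl

/-- A clause row evaluates to the load. -/
theorem rowVal_inc (k : ℕ) (c : ℕ → ℕ) : rowVal 40 (incRowZ k) c = (load c k : ℤ) := by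
  rw [incRowZ, rowVal_map, load]; push_cast
  exact Finset.sum_congr rfl fun a _ => by ring

/-- A negated clause row evaluates to minus the load. -/
theorem rowVal_negInc (k : ℕ) (c : ℕ → ℕ) : rowVal 40 (negIncRowZ k) c = -(load c k : ℤ) := by
  rw [negIncRowZ, rowVal_map, load]; push_cast
  rw [← Finset.sum_neg_distrib]
  exact Finset.sum_congr rfl fun a _ => by ring

/-- A difference row evaluates to the difference of the loads. -/
theorem rowVal_diff (k₁ k₂ : ℕ) (c : ℕ → ℕ) : rowVal 40 (diffRowZ k₁ k₂) c = (load c k₁ : ℤ) - load c k₂ := by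
  rw [diffRowZ, rowVal_map, load, load]; push_cast
  rw [← Finset.sum_sub_distrib]
  exact Finset.sum_congr rfl fun a _ => by ring

/-- The all-ones row evaluates to the total. -/
theorem rowVal_ones (c : ℕ → ℕ) : rowVal 40 onesRowZ c = (tot c : ℤ) := by
  rw [onesRowZ, rowVal_map, tot]; push_cast
  exact Finset.sum_congr rfl fun a _ => by ring

/-- The negated all-ones row evaluates to minus the total. -/
theorem rowVal_negOnes (c : ℕ → ℕ) : rowVal 40 negOnesRowZ c = -(tot c : ℤ) := by
  rw [negOnesRowZ, rowVal_map, tot]; push_cast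
  rw [← Finset.sum_neg_distrib]
  exact Finset.sum_congr rfl fun a _ => by ring

/-- The rank-one indicator row evaluates to `−σ`. -/
theorem rowVal_rk1 (c : ℕ → ℕ) : rowVal 40 rk1RowZ c = -(acnt c : ℤ) := by
  rw [rk1RowZ, rowVal_map, acnt]
  rw [Finset.range_eq_Ico, ← Finset.sum_Ico_consecutive _ (show 0 ≤ 24 by norm_num) (show 24 ≤ 40 by norm_num)]
  have h1 : ∑ a ∈ Ico 0 24, (if 24 ≤ a then (-1 : ℤ) else 0) * (c a : ℤ) = 0 :=
    Finset.sum_eq_zero fun a ha => by rw [Finset.mem_Ico] at ha; rw [if_neg (by omega), zero_mul]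
  have h2 : ∑ a ∈ Ico 24 40, (if 24 ≤ a then (-1 : ℤ) else 0) * (c a : ℤ) = ∑ a ∈ Ico 24 40, -(c a : ℤ) :=
    Finset.sum_congr rfl fun a ha => by rw [Finset.mem_Ico] at ha; rw [if_pos ha.1]; ring
  rw [h1, h2, zero_add, Finset.sum_neg_distrib]; push_cast; rfl

/-- The common rows hold for an admissible vector. -/
theorem baseSpec_holds (c : ℕ → ℕ) (h : Adm930 c) (k : ℕ) (hk : k < 85) : rowVal 40 (baseSpec k).1 c ≤ (baseSpec k).2 := by
  obtain ⟨hcap, -, htot, hac⟩ := h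
  by_cases h82 : k < 82
  · simp only [baseSpec, if_pos h82, rowVal_inc]; exact_mod_cast hcap k h82
  by_cases e82 : k = 82
  · subst e82; change rowVal 40 onesRowZ c ≤ 30; rw [rowVal_ones]; omega
  by_cases e83 : k = 83
  · subst e83; change rowVal 40 negOnesRowZ c ≤ -30; rw [rowVal_negOnes]; omega
  · have e84 : k = 84 := by omega
    subst e84; change rowVal 40 rk1RowZ c ≤ -14; rw [rowVal_rk1]; omega

/-- **Case `N`'s system holds** for an admissible, sorted vector with load `35 ≤ 3`. -/
theorem sat_rowsN (c : ℕ → ℕ) (h : Adm930 c) (hs : SortedRC c) (h35 : load c 35 ≤ 3) : Sat 40 rowsN c := by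
  intro k hk
  rw [rowsN_eq.1] at hk
  rw [rowsN_eq.2 k hk]
  obtain ⟨l32, l36⟩ := load_32_36 c h hs
  obtain ⟨s1, s2, s3, t1, t2, t3⟩ := hs
  by_cases h85 : k < 85
  · simp only [specN, if_pos h85]; exact baseSpec_holds c h k h85
  · interval_cases k
    · change rowVal 40 (diffRowZ 33 32) c ≤ 0; rw [rowVal_diff]; omega
    · change rowVal 40 (diffRowZ 34 33) c ≤ 0; rw [rowVal_diff]; omega
    · change rowVal 40 (diffRowZ 35 34) c ≤ 0; rw [rowVal_diff]; omega
    · change rowVal 40 (diffRowZ 37 36) c ≤ 0; rw [rowVal_diff]; omega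
    · change rowVal 40 (diffRowZ 38 37) c ≤ 0; rw [rowVal_diff]; omega
    · change rowVal 40 (diffRowZ 39 38) c ≤ 0; rw [rowVal_diff]; omega
    · change rowVal 40 (negIncRowZ 32) c ≤ -4; rw [rowVal_negInc]; omega
    · change rowVal 40 (negIncRowZ 36) c ≤ -4; rw [rowVal_negInc]; omega
    · change rowVal 40 (incRowZ 35) c ≤ 3; rw [rowVal_inc]; omega

/-- **The all-4 system holds** for an admissible all-4 vector. -/
theorem sat_rowsA (c : ℕ → ℕ) (h : Adm930 c) (h4 : All4 c) : Sat 40 rowsA c := by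
  intro k hk
  rw [rowsA_eq.1] at hk
  rw [rowsA_eq.2 k hk]
  by_cases h85 : k < 85
  · simp only [specA, if_pos h85]; exact baseSpec_holds c h k h85
  · simp only [specA, if_neg h85, rowVal_negInc]
    have := h4 (k - 85 + 32) (by omega) (by omega)
    omega

/-! ## The boxes -/

/-- The box tables, entrywise. -/
theorem boxes_eq : ∀ b, b < 40 → lo0.getD b 0 = 0 ∧ hi3.getD b 0 = 3 ∧ (loK.getD b 0 = if b = 0 ∨ b = 1 then 1 else 0) ∧
    (loG.getD b 0 = if b = 0 ∨ b = 5 then 1 else 0) ∧ (hiG.getD b 0 = if b ∈ cyc4L then 0 else 3) ∧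
    (loT.getD b 0 = if b = 0 ∨ b = 4 then 1 else 0) ∧ (hiT.getD b 0 = if b ∈ cyc4L ∨ b ∈ cyc3L then 0 else 3) ∧
    (hiD.getD b 0 = if b ∈ cyc4L ∨ b ∈ cyc3L ∨ b ∈ transL then 0 else 3) := by decide

/-- The box tables have 40 entries. -/
theorem boxes_length : lo0.length = 40 ∧ hi3.length = 40 ∧ loK.length = 40 ∧ loG.length = 40 ∧ hiG.length = 40 ∧
    loT.length = 40 ∧ hiT.length = 40 ∧ hiD.length = 40 := by decide

/-! ## From listed solutions to words -/

/-- Representative `j` (`0` = `M1`, `1` = `M2`) as a count vector. -/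
def repv930 (j : ℕ) : ℕ → ℕ := fun b => (rep930cL.getD j []).getD b 0

/-- The solution certificates: representative index, word in the generators, and the word reproduces the solution. -/
theorem certsK_fact : (∀ e ∈ certsK, e.2.1 < 2 ∧ WordOK e.2.2 ∧ actW e.2.2 (rep930cL.getD e.2.1 []) = e.1) ∧
    solsK = certsK.map (fun e => e.1) ∧ (∀ j, j < 2 → (rep930cL.getD j []).length = 40) := by decide

/-- **A listed solution is a group image of a representative.** -/
theorem word_of_listed {c : ℕ → ℕ} (hl : Listed 40 solsK c) : ∃ j, j < 2 ∧ ∃ w, WordOK w ∧ Eq40 c (actWS w (repv930 j)) := by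
  obtain ⟨v, hv, hcv⟩ := hl
  obtain ⟨hcerts, hsols, hlen⟩ := certsK_fact
  rw [hsols, List.mem_map] at hv
  obtain ⟨e, he, rfl⟩ := hv
  obtain ⟨hj, hw, hact⟩ := hcerts e he
  refine ⟨e.2.1, hj, e.2.2, hw, fun b hb => ?_⟩
  rw [hcv b hb, ← hact]
  exact actW_getD e.2.2 hw _ (hlen _ hj) b hb

/-- Transport of a word certificate back along a WLOG word. -/
theorem uncertify930 {c : ℕ → ℕ} {v : List ℕ} (hv : WordOK v) {j : ℕ} {w : List ℕ} (hw : WordOK w)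
    (h : Eq40 (actWS v c) (actWS w (repv930 j))) : ∃ w', WordOK w' ∧ Eq40 c (actWS w' (repv930 j)) := by
  refine ⟨w ++ invW v, wordOK_append hw (wordOK_invW hv), fun b hb => ?_⟩
  rw [actWS_append, ← actWS_invW v hv c b hb]
  exact actWS_congr _ (wordOK_invW hv) h b hb

/-! ## WLOG 2 and the cover theorem -/

/-- In the all-4 position an invertible class is present. -/
theorem exists_inv_pos930 {c : ℕ → ℕ} (h : Adm930 c) (h4 : All4 c) : ∃ a₀, a₀ < 24 ∧ 1 ≤ c a₀ := by
  by_contra hne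
  push Not at hne
  have hb : bcnt c = 0 := Finset.sum_eq_zero fun a ha => by
    have := hne a (Finset.mem_range.mp ha); omega
  have ht := tot_eq c
  have hr := (plane_sums c).1
  have := h4 32 (by norm_num) (by norm_num); have := h4 33 (by norm_num) (by norm_num)
  have := h4 34 (by norm_num) (by norm_num); have := h4 35 (by norm_num) (by norm_num)
  have := h.2.2.1
  omega

/-- **The cover theorem, given the kernel replays.** Every admissible count vector of the loaded branch at `(9,30)` is a group
image — by a word in the five generators — of `cnt M1` (`repv930 0`) or `cnt M2` (`repv930 1`). -/
theorem cover930_of_covers (hN : Covers rowsN [] 40 lo0 hi3) (hK : Covers rowsA solsK 40 loK hi3) (hG : Covers rowsA [] 40 loG hiG)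
    (hT : Covers rowsA [] 40 loT hiT) (hD : Covers rowsA [] 40 lo0 hiD) (c : ℕ → ℕ) (h : Adm930 c) :
    ∃ j, j < 2 ∧ ∃ w, WordOK w ∧ Eq40 c (actWS w (repv930 j)) := by
  -- WLOG 1: sorted plane loads
  obtain ⟨v₁, hv₁, hs⟩ := exists_sorted c h
  set c₁ := actWS v₁ c with hc₁
  have h₁ : Adm930 c₁ := adm930_actWS v₁ hv₁ h
  suffices H : ∃ j, j < 2 ∧ ∃ w, WordOK w ∧ Eq40 c₁ (actWS w (repv930 j)) by
    obtain ⟨j, hj, w, hw, he⟩ := H; exact ⟨j, hj, uncertify930 hv₁ hw he⟩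
  by_cases h35 : load c₁ 35 ≤ 3
  · -- case N: empty
    exfalso
    refine not_listed_nil (hN c₁ (fun b hb => ?_) (sat_rowsN c₁ h₁ hs h35))
    obtain ⟨e0, e3, -⟩ := boxes_eq b hb
    rw [e0, e3]; exact ⟨Nat.zero_le _, h₁.2.1 b hb⟩
  have h4 : All4 c₁ := all4_of_sorted c₁ h₁ hs h35
  -- WLOG 2a: translate a present invertible class to class 0
  obtain ⟨a₀, ha₀, ha1⟩ := exists_inv_pos930 h₁ h4
  obtain ⟨hsrc, hv₂⟩ := wTrans_fact a₀ ha₀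
  set v₂ := wTransL.getD a₀ [] with hv₂def
  set c₂ := actWS v₂ c₁ with hc₂
  have h₂ : Adm930 c₂ := adm930_actWS v₂ hv₂ h₁
  have h4₂ : All4 c₂ := all4_actWS v₂ hv₂ h4
  have h0 : 1 ≤ c₂ 0 := by rw [hc₂, actWS_apply, hsrc]; exact ha1
  suffices H : ∃ j, j < 2 ∧ ∃ w, WordOK w ∧ Eq40 c₂ (actWS w (repv930 j)) by
    obtain ⟨j, hj, w, hw, he⟩ := H; exact ⟨j, hj, uncertify930 hv₂ hw he⟩
  -- the box/system check for a moved vector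
  have mk : ∀ (u : List ℕ), WordOK u → ∀ (LO HI : List ℕ),
      (∀ b, b < 40 → LO.getD b 0 ≤ actWS u c₂ b ∧ actWS u c₂ b ≤ HI.getD b 0) →
      InBox 40 LO HI (actWS u c₂) ∧ Sat 40 rowsA (actWS u c₂) := fun u hu LO HI hB =>
    ⟨hB, sat_rowsA _ (adm930_actWS u hu h₂) (all4_actWS u hu h4₂)⟩
  by_cases hk4 : ∃ a, a ∈ cyc4L ∧ 1 ≤ c₂ a
  · -- case κ
    obtain ⟨a, ha, ha1'⟩ := hk4
    obtain ⟨hs0, hs1, hu⟩ := wKap_fact a ha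
    set u := wKapC.getD a [] with hudef
    obtain ⟨hB, hS⟩ := mk u hu loK hi3 fun b hb => by
      obtain ⟨-, e3, eK, -⟩ := boxes_eq b hb
      rw [e3, eK, actWS_apply]
      refine ⟨?_, (adm930_actWS u hu h₂).2.1 b hb |>.trans_eq' (by rw [actWS_apply])⟩
      split_ifs with h01
      · rcases h01 with rfl | rfl
        · rw [hs0]; exact h0
        · rw [hs1]; exact ha1'
      · exact Nat.zero_le _
    obtain ⟨j, hj, w, hw, he⟩ := word_of_listed (hK _ hB hS)
    exact ⟨j, hj, uncertify930 hu hw he⟩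
  push Not at hk4
  by_cases hk3 : ∃ a, a ∈ cyc3L ∧ 1 ≤ c₂ a
  · -- case γ: empty
    exfalso
    obtain ⟨a, ha, ha1'⟩ := hk3
    obtain ⟨hs0, hs5, hu, h4c⟩ := wGam_fact a ha
    set u := wGamC.getD a [] with hudef
    obtain ⟨hB, hS⟩ := mk u hu loG hiG fun b hb => by
      obtain ⟨-, -, -, eG, eG', -⟩ := boxes_eq b hb
      rw [eG, eG', actWS_apply]
      have hsb := srcW_lt _ hu b hb
      refine ⟨?_, ?_⟩
      · split_ifs with h05
        · rcases h05 with rfl | rfl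
          · rw [hs0]; exact h0
          · rw [hs5]; exact ha1'
        · exact Nat.zero_le _
      · split_ifs with hc4
        · have := hk4 _ (h4c b hc4); omega
        · exact h₂.2.1 _ hsb
    exact not_listed_nil (hG _ hB hS)
  push Not at hk3
  by_cases hk2 : ∃ a, a ∈ transL ∧ 1 ≤ c₂ a
  · -- case τ: empty
    exfalso
    obtain ⟨a, ha, ha1'⟩ := hk2
    obtain ⟨hs0, hs4, hu, h4c, h3c⟩ := wTau_fact a ha
    set u := wTauC.getD a [] with hudef
    obtain ⟨hB, hS⟩ := mk u hu loT hiT fun b hb => by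
      obtain ⟨-, -, -, -, -, eT, eT', -⟩ := boxes_eq b hb
      rw [eT, eT', actWS_apply]
      have hsb := srcW_lt _ hu b hb
      refine ⟨?_, ?_⟩
      · split_ifs with h04
        · rcases h04 with rfl | rfl
          · rw [hs0]; exact h0
          · rw [hs4]; exact ha1'
        · exact Nat.zero_le _
      · split_ifs with hc
        · rcases hc with hc | hc
          · have := hk4 _ (h4c b hc); omega
          · have := hk3 _ (h3c b hc); omega
        · exact h₂.2.1 _ hsb
    exact not_listed_nil (hT _ hB hS)
  push Not at hk2
  -- case δ: only the identity and the double transpositions remain: empty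
  exfalso
  obtain ⟨hB, hS⟩ := mk [] (fun _ h => by simp at h) lo0 hiD fun b hb => by
    obtain ⟨e0, -, -, -, -, -, -, eD⟩ := boxes_eq b hb
    rw [e0, eD]
    refine ⟨Nat.zero_le _, ?_⟩
    show c₂ b ≤ _
    split_ifs with hc
    · rcases hc with hc | hc | hc
      · have := hk4 _ hc; omega
      · have := hk3 _ hc; omega
      · have := hk2 _ hc; omega
    · exact h₂.2.1 _ hb
  exact not_listed_nil (hD _ hB hS)

end Summit.MatrixMultiplication.OmegaCensus.SmallFormats.Cover930
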